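import Summits.AtomisticToContinuum.Crystallization.Theorems.FrustratedLawDichotomyStrainedPatchHomEntryLeafHTU
import Summits.AtomisticToContinuum.Crystallization.Theorems.FrustratedLawDichotomyStrainedPatchHomEntryLeafHTCross095hB

/-!
# The fused one-fact certificate side at the `0.95 t_b` cell of entry half-width `2⁻¹³` (`cX95h × wXh`), MEASURED — with the certificate OF RECORD unchanged
# (27623 `(H) HomFloor (1/625)`, hcp half; hand-1 g32; critic rows 1226 (a) / 1228 (b))

decomp-a2c hand-1 g32 (crux `AperiodicFrustratedLawGap`, stmt-AtomisticToContinuum-27623).  Cell `cX95h × wXh` and certificate `pX95h` of `…HomEntryLeafHTCross095hA/B`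
(hand-1 g31).  Here the all-naive far chunks FIT INSIDE THE `Gs` OF RECORD: near `≤ 613·10⁹` (`…Cross095hB.slope_near_X95h`) + far naive `7.25·10⁹ + 3.37·10⁹`
`≤ 625·10⁹ = pX95h.Gs`, so the fused certificate side holds for the UNCHANGED payload: ★★ `htCertSideU_X95h : htCertSideU pX95h cX95h wXh = true`, ONE
`decide +kernel` fact (reduced universe `1218` labels: near 350 / far₁ 357 / far₂ 399 / straddlers 8).  Third/fourth measured leaf for the census' per-leaf
cost constant (timings in the hand-1 g32 FINDING memo).

Kernel fact; 0 sorry; standard axioms.  `--supports stmt-AtomisticToContinuum-27623`.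
-/

namespace Summit.AtomisticToContinuum.Crystallization.Theorems.FrustratedLawDichotomyStrainedPatchHomEntryLeafHT

open Literature.Analysis.ValidatedNumerics.Numerics

set_option maxRecDepth 100000 in
set_option maxHeartbeats 4000000 in
/-- ★★ **KERNEL: THE FUSED CERTIFICATE SIDE OF THE `0.95 t_b` CELL AT `U 2⁻¹³` IS ONE FACT, for the certificate of record `pX95h`.** -/
theorem htCertSideU_X95h : htCertSideU pX95h cX95h wXh = true := by
  decide +kernel

end Summit.AtomisticToContinuum.Crystallization.Theorems.FrustratedLawDichotomyStrainedPatchHomEntryLeafHT
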